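import Summits.ValiantsHypothesis.ValiantsHypothesis.Theorems.LacunarySymmetroidMatrixDescartesCensusTropicalKLawStatic

/-!
# Route `KPlusLogSqLaw`, crux `TropicalB` — the STATIC (PORT) EMBEDDING, part 1: the port design (definitions)

HONEST FRAMING.  Definitions file (D-0009: reviewed/audited) for the support theorem `tropRootLawAt_of_static_ports`
(`…Theorems.KPlusLogSqLawTropicalBStaticPorts`) toward the registered stubs `stub_tropThin` / `stub_tropFat` of the crux
`TropicalB` (ledger item `stmt-ValiantsHypothesis-19771`, route `KPlusLogSqLaw`; cell `pub-symmetroid`, seat val-sym-trop-p4,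
2026-08-26).  It defines a GADGET — no candidate law, no `Prop` is asserted — and proves its bookkeeping identities.
Nothing here bears on `TropicalB` inside its window, `Lifting`, `KPlusLogSqLaw`, `MatrixDescartes` or `VP ≠ VNP`.

THE GADGET («ports», star form; `K = K' + 1`, hub `= Fin.last K'`).  Given a dominance design of format `(m, K'+1)`
(exponents `d`, valuations `v`, signs `ε`), index rows and columns of a big matrix by `Fin m × Fin (K'+1)` (transported to
`Fin (m·(K'+1))` by `finProdFinEquiv`).  Column `(j, l)` = PORT `l` of group `j` (the hub is port `last`); row `(i, last)` =
ORIGINAL row `i`; row `(j, t)`, `t ≠ last` = AUX row `t` of group `j`.  Entries (`portE`, `portV`): original row `i` to port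
`(j, l)` carries class `l` with the original `(v, ε)` of `(i, j, l)`; aux row `(j, t)` to its own port `(j, t)`: class `0`,
`v = 0`, `ε = +1`; aux row `(j, t)` to the hub `(j, last)`: class `0`, `v = 0`, `ε = −1`; nothing else (so the design is
STATIC, `bigE_static`).  The image of the term `(σ, λ)` (`bigTerm`): permutation `portPerm σ λ = rowperm σ ∘ colperm λ`
(`rowperm σ = prodCongrLeft (σ on slot last)`, `colperm λ = prodCongrRight (j ↦ swap last (λ j))`; three-case formula
`portPerm_apply`: free port `(j, λ j) ↦` original row `σ j`, hub `↦` aux row `(j, λ j)` when not free, other ports `↦` their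
own aux rows) and class map `portCls λ` (class `λ j` at the free port, `0` elsewhere).  Bookkeeping proved here:
`portV_portPerm`, `portE_portPerm` (what each column picks up), `sign_portPerm`
(`sign = sign σ · ∏ⱼ sign (swap last (λ j))`), `bigE_natAbs_le`, `bigE_static`, two slot sums.  The weight/sign/surjectivity
theorems and the embedding itself are in part 2.

[folklore] (gadget: parallel classes → ports with a star of auxiliary rows).
-/

-- `Summit.ValiantsHypothesis.ValiantsHypothesis.…` repeats a component by the D-0017 layout
-- (single-conjunct summit), which the `dupNamespace` linter flags; the name is mandated.
set_option linter.dupNamespace false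
set_option autoImplicit false

namespace Summit.ValiantsHypothesis.ValiantsHypothesis.Theorems.LacunarySymmetroidMatrixDescartes.TropicalCensus

open Summit.ValiantsHypothesis.ValiantsHypothesis.Theorems.MatrixDescartes.Negative
open Finset

namespace StaticPorts

variable {m K' : ℕ}

/-! ## 1. The port design on the structured index type `Fin m × Fin (K'+1)` -/

/-- signs of the port design: original row `(i, last)` to port `(j, l')` carries class `l'` with sign `ε i j l'`; aux row
`(i, s)` (`s ≠ last`) to its own port `(i, s)` sign `+1`, to the hub `(i, last)` sign `−1`, class `0`; all else absent. -/
def portE (ε : Fin m → Fin m → Fin (K' + 1) → ℤ) (r c : Fin m × Fin (K' + 1)) (l : Fin (K' + 1)) : ℤ :=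
  if r.2 = Fin.last K' then (if l = c.2 then ε r.1 c.1 l else 0)
  else (if c.1 = r.1 ∧ l = 0 then (if c.2 = r.2 then 1 else if c.2 = Fin.last K' then -1 else 0) else 0)

/-- valuations of the port design: the original valuation on original rows, `0` on aux rows. -/
def portV (v : Fin m → Fin m → Fin (K' + 1) → ℤ) (r c : Fin m × Fin (K' + 1)) (l : Fin (K' + 1)) : ℤ :=
  if r.2 = Fin.last K' then v r.1 c.1 l else 0

/-- the row part of the big permutation: `σ` on the original rows (slot `last`), identity on aux rows. -/
def rowperm (σ : Equiv.Perm (Fin m)) : Equiv.Perm (Fin m × Fin (K' + 1)) :=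
  Equiv.prodCongrLeft fun s => if s = Fin.last K' then σ else 1

/-- the column part of the big permutation: in group `j` swap the hub with the free port `λ j`. -/
def colperm (lam : Fin m → Fin (K' + 1)) : Equiv.Perm (Fin m × Fin (K' + 1)) :=
  Equiv.prodCongrRight fun j => Equiv.swap (Fin.last K') (lam j)

/-- the big permutation of the term `(σ, λ)` (columns ↦ rows). -/
def portPerm (σ : Equiv.Perm (Fin m)) (lam : Fin m → Fin (K' + 1)) : Equiv.Perm (Fin m × Fin (K' + 1)) :=
  rowperm σ * colperm lam

/-- the big class map of the term `(σ, λ)`: the free port `(j, λ j)` carries class `λ j`, every other column class `0`. -/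
def portCls (lam : Fin m → Fin (K' + 1)) (c : Fin m × Fin (K' + 1)) : Fin (K' + 1) :=
  if c.2 = lam c.1 then c.2 else 0

/-- the three-case formula for the big permutation. -/
theorem portPerm_apply (σ : Equiv.Perm (Fin m)) (lam : Fin m → Fin (K' + 1)) (j : Fin m) (l' : Fin (K' + 1)) :
    portPerm σ lam (j, l') =
      if l' = lam j then (σ j, Fin.last K')
      else if l' = Fin.last K' then (j, lam j) else (j, l') := by
  unfold portPerm rowperm colperm
  rw [Equiv.Perm.mul_apply, Equiv.prodCongrRight_apply, Equiv.prodCongrLeft_apply]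
  by_cases h1 : l' = lam j
  · subst h1
    rw [Equiv.swap_apply_right]
    simp
  · rw [if_neg h1]
    by_cases h2 : l' = Fin.last K'
    · subst h2
      rw [Equiv.swap_apply_left, if_pos rfl]
      have : lam j ≠ Fin.last K' := fun h => h1 h.symm
      simp [this]
    · rw [Equiv.swap_apply_of_ne_of_ne h2 h1, if_neg h2]
      simp [h2]

/-- the row at column `(j, l')` is an original row iff `l'` is the free port `λ j`. -/
theorem portPerm_snd_eq_last_iff (σ : Equiv.Perm (Fin m)) (lam : Fin m → Fin (K' + 1)) (j : Fin m)
    (l' : Fin (K' + 1)) : (portPerm σ lam (j, l')).2 = Fin.last K' ↔ l' = lam j := by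
  rw [portPerm_apply]
  by_cases h1 : l' = lam j
  · simp [h1]
  · rw [if_neg h1]
    by_cases h2 : l' = Fin.last K'
    · rw [if_pos h2]
      simp only
      constructor
      · intro h; exact absurd (h2.trans h.symm) h1
      · intro h; exact absurd h h1
    · rw [if_neg h2]
      simp only
      constructor
      · intro h; exact absurd h h2
      · intro h; exact absurd h h1

/-! ## 2. Weight, sign, presence of the image term -/

/-- valuation picked up at column `(j, l')`: the original one at the free port, `0` elsewhere. -/
theorem portV_portPerm (v : Fin m → Fin m → Fin (K' + 1) → ℤ) (σ : Equiv.Perm (Fin m)) (lam : Fin m → Fin (K' + 1))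
    (j : Fin m) (l' : Fin (K' + 1)) :
    portV v (portPerm σ lam (j, l')) (j, l') (portCls lam (j, l')) = if l' = lam j then v (σ j) j (lam j) else 0 := by
  unfold portV portCls
  by_cases h1 : l' = lam j
  · rw [portPerm_apply, if_pos h1, if_pos h1]
    simp [h1]
  · have h2 : (portPerm σ lam (j, l')).2 ≠ Fin.last K' := fun h => h1 ((portPerm_snd_eq_last_iff σ lam j l').mp h)
    rw [if_neg h2, if_neg h1]

/-- sign picked up at column `(j, l')`: `ε (σ j) j (λ j)` at the free port, `−1` at the hub when the hub is not free,
`+1` elsewhere. -/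
theorem portE_portPerm (ε : Fin m → Fin m → Fin (K' + 1) → ℤ) (σ : Equiv.Perm (Fin m)) (lam : Fin m → Fin (K' + 1))
    (j : Fin m) (l' : Fin (K' + 1)) :
    portE ε (portPerm σ lam (j, l')) (j, l') (portCls lam (j, l')) =
      if l' = lam j then ε (σ j) j (lam j) else if l' = Fin.last K' then -1 else 1 := by
  unfold portE portCls
  by_cases h1 : l' = lam j
  · rw [portPerm_apply, if_pos h1, if_pos h1, if_pos h1]
    simp [h1]
  · have h2 : (portPerm σ lam (j, l')).2 ≠ Fin.last K' := fun h => h1 ((portPerm_snd_eq_last_iff σ lam j l').mp h)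
    rw [if_neg h2, if_neg h1, if_neg h1, portPerm_apply, if_neg h1]
    by_cases h3 : l' = Fin.last K'
    · rw [if_pos h3, if_pos h3]
      have h4 : lam j ≠ Fin.last K' := fun h => h1 (h3.trans h.symm)
      simp [h3, Ne.symm h4]
    · rw [if_neg h3, if_neg h3]
      simp [h3]

/-- sign of the big permutation: `sign σ · ∏ⱼ sign (swap last (λ j))`. -/
theorem sign_portPerm (σ : Equiv.Perm (Fin m)) (lam : Fin m → Fin (K' + 1)) :
    (Equiv.Perm.sign (portPerm σ lam) : ℤ) =
      (Equiv.Perm.sign σ : ℤ) * ∏ j, (if lam j = Fin.last K' then (1 : ℤ) else -1) := by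
  unfold portPerm rowperm colperm
  rw [Equiv.Perm.sign_mul, Equiv.Perm.sign_prodCongrLeft, Equiv.Perm.sign_prodCongrRight]
  have h1 : (∏ s : Fin (K' + 1), Equiv.Perm.sign (if s = Fin.last K' then σ else 1)) = Equiv.Perm.sign σ := by
    rw [Finset.prod_eq_single (Fin.last K')]
    · simp
    · intro s _ hs; simp [hs]
    · intro h; exact absurd (mem_univ _) h
  rw [h1, Units.val_mul, Units.coe_prod]
  congr 1
  refine prod_congr rfl fun j _ => ?_
  rw [Equiv.Perm.sign_swap']
  by_cases h : lam j = Fin.last K'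
  · simp [h]
  · simp [h, Ne.symm h]

/-- slot sum of one group: one distinguished slot worth `A`, the other `K'` slots worth `B`. -/
theorem sum_ite_eq_add (a : Fin (K' + 1)) (A B : ℤ) :
    ∑ l' : Fin (K' + 1), (if l' = a then A else B) = A + K' * B := by
  have h : ∀ l' : Fin (K' + 1), (if l' = a then A else B) = B + (if l' = a then A - B else 0) := by
    intro l'; split_ifs <;> ring
  rw [sum_congr rfl (fun l' _ => h l'), sum_add_distrib, sum_const, card_univ, Fintype.card_fin,
    sum_ite_eq' univ a, if_pos (mem_univ _), nsmul_eq_mul]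
  push_cast
  ring

/-- slot product of one group: `A` at the distinguished slot, `−1` at the hub if the hub is not distinguished. -/
theorem prod_ite_ite_eq (a : Fin (K' + 1)) (A : ℤ) :
    ∏ l' : Fin (K' + 1), (if l' = a then A else if l' = Fin.last K' then -1 else 1) =
      A * (if a = Fin.last K' then 1 else -1) := by
  rw [← Finset.mul_prod_erase univ _ (mem_univ a), if_pos rfl]
  congr 1
  by_cases ha : a = Fin.last K'
  · rw [if_pos ha]
    refine prod_eq_one fun l' hl' => ?_
    have h1 : l' ≠ a := ne_of_mem_erase hl'
    rw [if_neg h1, if_neg (ha ▸ h1)]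
  · rw [if_neg ha]
    rw [prod_eq_single_of_mem (Fin.last K') (mem_erase.mpr ⟨Ne.symm ha, mem_univ _⟩)]
    · rw [if_neg (Ne.symm ha), if_pos rfl]
    · intro l' hl' hne
      rw [if_neg (ne_of_mem_erase hl'), if_neg hne]

/-! ## 3. Transport to `Fin (m·(K'+1))` and the image term -/

/-- big signs on `Fin (m·(K'+1))` -/
def bigE (ε : Fin m → Fin m → Fin (K' + 1) → ℤ) (x y : Fin (m * (K' + 1))) (l : Fin (K' + 1)) : ℤ :=
  portE ε (finProdFinEquiv.symm x) (finProdFinEquiv.symm y) l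

/-- big valuations on `Fin (m·(K'+1))` -/
def bigV (v : Fin m → Fin m → Fin (K' + 1) → ℤ) (x y : Fin (m * (K' + 1))) (l : Fin (K' + 1)) : ℤ :=
  portV v (finProdFinEquiv.symm x) (finProdFinEquiv.symm y) l

/-- the image of the term `(σ, λ)` in the big static design -/
def bigTerm (p : Equiv.Perm (Fin m) × (Fin m → Fin (K' + 1))) :
    Equiv.Perm (Fin (m * (K' + 1))) × (Fin (m * (K' + 1)) → Fin (K' + 1)) :=
  (finProdFinEquiv.permCongr (portPerm p.1 p.2), fun y => portCls p.2 (finProdFinEquiv.symm y))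

/-- signs of the big design lie in `{−1, 0, 1}` -/
theorem bigE_natAbs_le (ε : Fin m → Fin m → Fin (K' + 1) → ℤ) (hε : ∀ i j l, (ε i j l).natAbs ≤ 1)
    (x y : Fin (m * (K' + 1))) (l : Fin (K' + 1)) : (bigE ε x y l).natAbs ≤ 1 := by
  unfold bigE portE
  split_ifs <;> simp [hε]

/-- the big design is static -/
theorem bigE_static (ε : Fin m → Fin m → Fin (K' + 1) → ℤ) : IsStatic (bigE ε) := by
  intro x y l l' h h'
  unfold bigE portE at h h'
  split_ifs at h h' <;> simp_all

end StaticPorts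

end Summit.ValiantsHypothesis.ValiantsHypothesis.Theorems.LacunarySymmetroidMatrixDescartes.TropicalCensus
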